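import Mathlib
import Summits.AtomisticToContinuum.FouriersLaw.Theorems.ContactStieltjesMeasureContactMeasureLimitStubLayerCake

/-!
# Equal squared contact measures ⇒ equal values at continuity points
# (glue for crux `ContactMeasureLimit`, line `IdeatorOneSketch`)

Crux `ContactStieltjesMeasure.ContactMeasureLimit` (stmt-AtomisticToContinuum-15250), line `IdeatorOneSketch`
(idea `escaped-mass-stieltjes-constant`). In the Stieltjes continuity theorem for the contact kernel every
subsequential Helly limit `G` (monotone, zero on `(-∞,0]`) is encoded by its SQUARED CONTACT MEASURE
`ν_G := μ_G.map (s ↦ s²)`, `μ_G` the Lebesgue–Stieltjes measure of `rightLim G` (`Monotone.stieltjesFunction`);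
uniqueness of Stieltjes data identifies `ν_G` across subsequences, and this file transfers that identification
back to the functions: if `ν_{G₁} = ν_{G₂}` then `rightLim G₁ = rightLim G₂` on `(0,∞)` (atoms `{0}` and
increments `(0,b²]` of the squared measures), hence at every continuity point `t > 0` of `G₁` also `G₂` is
continuous and `G₁ t = G₂ t` (`sqMeasure_eq_at_continuity`). Elementary; Mathlib's `StieltjesFunction.measure`
API plus the Stieltjes-function facts of the landed `…StubLayerCake` file.
-/

noncomputable section

namespace Summit.AtomisticToContinuum.FouriersLaw.Theorems.ContactMeasureLimit

open MeasureTheory Filter Set Topology Function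

/-- The Stieltjes measure of a monotone `G` vanishing on `(-∞,0]` does not charge `(-∞,0)`. [folklore] -/
lemma sqMeasure_measure_Iio_zero {G : ℝ → ℝ} (hG : Monotone G) (hG0 : ∀ s : ℝ, s ≤ 0 → G s = 0) :
    hG.stieltjesFunction.measure (Iio 0) = 0 := by
  rw [StieltjesFunction.measure_Iio _ (layerCake_tendsto_stieltjes_atBot hG hG0),
    layerCake_leftLim_stieltjes_zero hG hG0]
  simp

/-- The atom at `0` of the Stieltjes measure of `G` is `rightLim G 0`. [folklore] -/
lemma sqMeasure_measure_singleton_zero {G : ℝ → ℝ} (hG : Monotone G)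
    (hG0 : ∀ s : ℝ, s ≤ 0 → G s = 0) :
    hG.stieltjesFunction.measure {0} = ENNReal.ofReal (rightLim G 0) := by
  rw [StieltjesFunction.measure_singleton, layerCake_leftLim_stieltjes_zero hG hG0,
    hG.stieltjesFunction_eq]
  simp

/-- Increments of the Stieltjes measure of `G` from `0`: `μ_G (0,b] = rightLim G b - rightLim G 0`. [folklore] -/
lemma sqMeasure_measure_Ioc_zero {G : ℝ → ℝ} (hG : Monotone G) (b : ℝ) :
    hG.stieltjesFunction.measure (Ioc 0 b) = ENNReal.ofReal (rightLim G b - rightLim G 0) := by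
  rw [StieltjesFunction.measure_Ioc, hG.stieltjesFunction_eq, hG.stieltjesFunction_eq]

/-- The squared measure of `{0}` is the atom `rightLim G 0`. [folklore] -/
lemma sqMeasure_sq_singleton {G : ℝ → ℝ} (hG : Monotone G) (hG0 : ∀ s : ℝ, s ≤ 0 → G s = 0) :
    (hG.stieltjesFunction.measure).map (fun s : ℝ => s ^ 2) {0} = ENNReal.ofReal (rightLim G 0) := by
  rw [Measure.map_apply (by fun_prop) (measurableSet_singleton 0)]
  have hpre : (fun s : ℝ => s ^ 2) ⁻¹' ({0} : Set ℝ) = {0} := by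
    ext s; simp
  rw [hpre, sqMeasure_measure_singleton_zero hG hG0]

/-- The squared measure of `(0, b²]` is `rightLim G b − rightLim G 0` (`b > 0`). [folklore] -/
lemma sqMeasure_sq_Ioc {G : ℝ → ℝ} (hG : Monotone G) (hG0 : ∀ s : ℝ, s ≤ 0 → G s = 0) {b : ℝ}
    (hb : 0 < b) :
    (hG.stieltjesFunction.measure).map (fun s : ℝ => s ^ 2) (Ioc 0 (b ^ 2)) =
      ENNReal.ofReal (rightLim G b - rightLim G 0) := by
  rw [Measure.map_apply (by fun_prop) measurableSet_Ioc]
  set P : Set ℝ := (fun s : ℝ => s ^ 2) ⁻¹' Ioc 0 (b ^ 2) with hP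
  have hsub1 : Ioc 0 b ⊆ P := by
    intro s hs
    refine ⟨pow_pos hs.1 2, ?_⟩
    exact pow_le_pow_left₀ hs.1.le hs.2 2
  have hsub2 : P ⊆ Ioc 0 b ∪ Iio 0 := by
    intro s hs
    rcases lt_or_ge s 0 with hs0 | hs0
    · exact Or.inr hs0
    · refine Or.inl ⟨?_, ?_⟩
      · rcases hs0.eq_or_lt with h0 | h0
        · exfalso; have := hs.1; rw [← h0] at this; simp at this
        · exact h0
      · exact le_of_pow_le_pow_left₀ two_ne_zero hb.le hs.2
  apply le_antisymm
  · calc hG.stieltjesFunction.measure P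
        ≤ hG.stieltjesFunction.measure (Ioc 0 b ∪ Iio 0) := measure_mono hsub2
      _ ≤ hG.stieltjesFunction.measure (Ioc 0 b) + hG.stieltjesFunction.measure (Iio 0) :=
          measure_union_le _ _
      _ = ENNReal.ofReal (rightLim G b - rightLim G 0) := by
          rw [sqMeasure_measure_Iio_zero hG hG0, add_zero, sqMeasure_measure_Ioc_zero hG]
  · calc ENNReal.ofReal (rightLim G b - rightLim G 0)
        = hG.stieltjesFunction.measure (Ioc 0 b) := (sqMeasure_measure_Ioc_zero hG b).symm
      _ ≤ hG.stieltjesFunction.measure P := measure_mono hsub1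

/-- `rightLim G ≥ 0` everywhere for a monotone `G` vanishing on `(-∞,0]`. [folklore] -/
lemma sqMeasure_rightLim_nonneg {G : ℝ → ℝ} (hG : Monotone G) (hG0 : ∀ s : ℝ, s ≤ 0 → G s = 0)
    (x : ℝ) : 0 ≤ rightLim G x := by
  have := hG.le_rightLim (le_refl x)
  rcases le_or_gt x 0 with hx | hx
  · rw [hG0 x hx] at this; exact this
  · exact le_trans (by rw [hG0 0 le_rfl]) ((hG hx.le).trans this)

/-- Equal squared contact measures ⇒ equal right limits on `(0, ∞)`. [folklore] -/
lemma sqMeasure_rightLim_eq {G₁ G₂ : ℝ → ℝ} (h₁ : Monotone G₁) (h₂ : Monotone G₂)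
    (h₁0 : ∀ s : ℝ, s ≤ 0 → G₁ s = 0) (h₂0 : ∀ s : ℝ, s ≤ 0 → G₂ s = 0)
    (h : (h₁.stieltjesFunction.measure).map (fun s : ℝ => s ^ 2) =
      (h₂.stieltjesFunction.measure).map (fun s : ℝ => s ^ 2)) {b : ℝ} (hb : 0 < b) :
    rightLim G₁ b = rightLim G₂ b := by
  have h0 : rightLim G₁ 0 = rightLim G₂ 0 := by
    have e : (h₁.stieltjesFunction.measure).map (fun s : ℝ => s ^ 2) {0} =
        (h₂.stieltjesFunction.measure).map (fun s : ℝ => s ^ 2) {0} := by rw [h]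
    rw [sqMeasure_sq_singleton h₁ h₁0, sqMeasure_sq_singleton h₂ h₂0] at e
    exact (ENNReal.ofReal_eq_ofReal_iff (sqMeasure_rightLim_nonneg h₁ h₁0 0)
      (sqMeasure_rightLim_nonneg h₂ h₂0 0)).1 e
  have hinc : rightLim G₁ b - rightLim G₁ 0 = rightLim G₂ b - rightLim G₂ 0 := by
    have e : (h₁.stieltjesFunction.measure).map (fun s : ℝ => s ^ 2) (Ioc 0 (b ^ 2)) =
        (h₂.stieltjesFunction.measure).map (fun s : ℝ => s ^ 2) (Ioc 0 (b ^ 2)) := by rw [h]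
    rw [sqMeasure_sq_Ioc h₁ h₁0 hb, sqMeasure_sq_Ioc h₂ h₂0 hb] at e
    exact (ENNReal.ofReal_eq_ofReal_iff (sub_nonneg.2 (h₁.rightLim hb.le))
      (sub_nonneg.2 (h₂.rightLim hb.le))).1 e
  linarith

/-- **Equal squared contact measures ⇒ equal values at continuity points.** If the squared contact measures of
two monotone functions `G₁, G₂` vanishing on `(-∞,0]` coincide, then at every continuity point `t > 0` of `G₁`
the function `G₂` is continuous too and `G₁ t = G₂ t`. [folklore] -/
theorem sqMeasure_eq_at_continuity :
    ∀ (G₁ G₂ : ℝ → ℝ) (h₁ : Monotone G₁) (h₂ : Monotone G₂), (∀ s : ℝ, s ≤ 0 → G₁ s = 0) →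
      (∀ s : ℝ, s ≤ 0 → G₂ s = 0) →
      (h₁.stieltjesFunction.measure).map (fun s : ℝ => s ^ 2) =
        (h₂.stieltjesFunction.measure).map (fun s : ℝ => s ^ 2) →
      ∀ t : ℝ, 0 < t → ContinuousAt G₁ t → ContinuousAt G₂ t ∧ G₁ t = G₂ t := by
  intro G₁ G₂ h₁ h₂ h₁0 h₂0 h t ht hc₁
  have hR : ∀ s, 0 < s → rightLim G₂ s = rightLim G₁ s := fun s hs =>
    (sqMeasure_rightLim_eq h₁ h₂ h₁0 h₂0 h hs).symm
  have hT : Tendsto G₂ (𝓝 t) (𝓝 (G₁ t)) := by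
    refine tendsto_order.2 ⟨fun x hx => ?_, fun x hx => ?_⟩
    · have hev : ∀ᶠ y in 𝓝 t, x < G₁ y := hc₁.eventually (lt_mem_nhds hx)
      obtain ⟨lo, hi, ⟨hlo, hhi⟩, hsub⟩ := mem_nhds_iff_exists_Ioo_subset.1 hev
      set s : ℝ := max ((lo + t) / 2) (t / 2) with hs
      have hs_pos : 0 < s := lt_of_lt_of_le (by linarith) (le_max_right _ _)
      have hs_lt : s < t := max_lt (by linarith) (by linarith)
      have hs_mem : s ∈ Ioo lo hi :=
        ⟨lt_of_lt_of_le (by linarith) (le_max_left _ _), hs_lt.trans hhi⟩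
      have hxs : x < G₁ s := hsub hs_mem
      filter_upwards [Ioi_mem_nhds hs_lt] with y hy
      calc x < G₁ s := hxs
        _ ≤ rightLim G₁ s := h₁.le_rightLim le_rfl
        _ = rightLim G₂ s := (hR s hs_pos).symm
        _ ≤ G₂ y := h₂.rightLim_le hy
    · have hev : ∀ᶠ y in 𝓝 t, G₁ y < x := hc₁.eventually (gt_mem_nhds hx)
      obtain ⟨lo, hi, ⟨hlo, hhi⟩, hsub⟩ := mem_nhds_iff_exists_Ioo_subset.1 hev
      set s' : ℝ := (t + hi) / 2 with hs'
      have hs'_gt : t < s' := by linarith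
      have hs'_mem : s' ∈ Ioo lo hi := ⟨by linarith, by linarith⟩
      have hxs' : G₁ s' < x := hsub hs'_mem
      filter_upwards [Ioo_mem_nhds ht hs'_gt] with y hy
      calc G₂ y ≤ rightLim G₂ y := h₂.le_rightLim le_rfl
        _ = rightLim G₁ y := hR y hy.1
        _ ≤ G₁ s' := h₁.rightLim_le hy.2
        _ < x := hxs'
  have hle : G₂ t ≤ G₁ t :=
    calc G₂ t ≤ rightLim G₂ t := h₂.le_rightLim le_rfl
      _ = rightLim G₁ t := hR t ht
      _ = G₁ t := rightLim_eq_of_tendsto (hc₁.tendsto.mono_left nhdsWithin_le_nhds)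
  have hge : G₁ t ≤ G₂ t := by
    have hlim : Tendsto G₁ (𝓝[<] t) (𝓝 (G₁ t)) := hc₁.tendsto.mono_left nhdsWithin_le_nhds
    refine le_of_tendsto hlim ?_
    filter_upwards [Ioo_mem_nhdsLT ht] with s hs
    calc G₁ s ≤ rightLim G₁ s := h₁.le_rightLim le_rfl
      _ = rightLim G₂ s := (hR s hs.1).symm
      _ ≤ G₂ t := h₂.rightLim_le hs.2
  have heq : G₁ t = G₂ t := le_antisymm hge hle
  refine ⟨?_, heq⟩
  show Tendsto G₂ (𝓝 t) (𝓝 (G₂ t))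
  rw [← heq]
  exact hT

end Summit.AtomisticToContinuum.FouriersLaw.Theorems.ContactMeasureLimit

end
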